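import Mathlib.Analysis.SpecialFunctions.Pow.Real
import Mathlib.LinearAlgebra.Matrix.PosDef
import Mathlib.LinearAlgebra.UnitaryGroup
import Mathlib.Analysis.Complex.Order
import Literature.Computability.Cryptography.QubitRegister
import HarnessLib

/-!
# Barrier catalogue `QuantumAdvantage` — upper bounds on the fault-tolerance noise threshold (Kempe–Regev–Unger–de Wolf; Razborov; Buhrman et al.)

Topic `Literature/Barriers/QuantumAdvantage` (D-0021). Summit statement:
`QuantumAdvantage := ∃ L, L ∈ BQP ∧ L ∉ BPP`.

The companion entry `Literature/Barriers/QuantumAdvantage/UncorrectedNoise.lean` records that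
sampling devices with a constant rate of *uncorrected* noise are classically simulable, and lists
**fault tolerance** (quantum error correction below threshold) as the published evasion. This
entry records the printed limits of that evasion: above explicit constant noise rates no circuit
in the respective model computes anything that depends on its input for more than logarithmic
(for one output qubit: constant) depth, whatever code or fault-tolerance scheme is used — the
respective models being NON-ADAPTIVE circuits all of whose registers are noisy ((i), (ii)) or
circuits with perfect stabilizer operations ((iii)); the barrier audit of 2026-08-16 records this
scope explicitly (`NoiseThresholdUpperBoundsNarrow`, see "Audit" below).

**The printed results.**

* J. Kempe, O. Regev, F. Unger, R. de Wolf, *Upper bounds on the noise threshold for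
  fault-tolerant quantum computing*, ICALP 2008 / Quantum Inf. Comput. 10 (2010) 361–376
  (arXiv:0802.1464) [KempeEtAl2010]. Model (§1 "Our model", arXiv p. 3): `n` wires,
  `T` levels; each level is a partition of the qubits with a gate on each block; gates are
  `k`-qubit probabilistic mixtures of unitaries, each *preceded* by `ε_k`-depolarizing noise on
  each input qubit with `ε_k > 1 − √(2^{1/k} − 1)`, and arbitrary (CPTP) one-qubit gates, each
  *followed* by `ε₁`-depolarizing noise, `ε₁ > 0`; output = measurement of a designated qubit in
  the computational basis. **Theorem 1**: "Fix any `T`-level quantum circuit as above. Then for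
  any two states `ρ` and `τ`, the probabilities of obtaining measurement outcome `1` at the output
  qubit starting from `ρ` and starting from `τ`, respectively, differ by at most `2^{−Ω(T)}`."
  For `k = 2` the bound is `35.7%`; if CNOT is the only two-qubit gate, `29.3%` (§4). Typed below
  as `kempeRegevUngerDeWolf2008_thm1` over an explicit rendering of this circuit model.
* A. Razborov, *An upper bound on the threshold quantum decoherence rate*, Quantum Inf. Comput.
  4 (2004) 222–228 (arXiv:quant-ph/0310136) [Razborov2004]. Model (§2): mixed-state circuits
  with arbitrary quantum operations of fan-in `≤ k` as gates, every level followed by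
  `η`-depolarization of *all* qubits. **Theorem 2.4**: "For every constants `k > 0` and
  `η > 1 − 1/k` there exists `C > 0` such that the following holds. For every quantum circuit `Q`
  over `𝒢_k` with `Depth(Q) ≥ C log Width(Q)`, the perturbed circuit `Q_η` is practically
  worthless" (Def. 2.3: `D(Q(ρ), Q(σ)) ≤ 1/100` for all `ρ, σ`); hence "no Boolean function
  `f ∈ QP ∖ QNC¹` can be computed fault-tolerantly", `η₀ ≤ 1/2` for fan-in `2`, and with one
  output qubit "practically worthless already within a constant number of steps" (p. 4).
* H. Buhrman, R. Cleve, M. Laurent, N. Linden, A. Schrijver, F. Unger, *New limits on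
  fault-tolerant quantum computation*, FOCS 2006, 411–419 (arXiv:quant-ph/0604141)
  [BuhrmanEtAl2006]. **Theorem 1**: perfect Clifford operations "together with 1-qubit gates with
  depolarizing noise more than `θ̂ = (6 − 2√2)/7 ≈ 45%` and one single-qubit measurement is not
  sufficient for arbitrary classical computation" (functions of unbounded-error communication
  complexity `> 1` cannot be computed); tight for the `π/8` gate given perfect stabilizer
  operations and classical control (magic-state distillation), §5.

Only Kempe et al.'s Theorem 1 is typed (the others need quantum operations between registers of
different sizes and the trace norm, which the tree does not have); Razborov's and Buhrman et
al.'s theorems are quoted with their constants in the barrier block.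

## Contents

* A minimal mixed-state rendering of the Kempe–Regev–Unger–de Wolf circuit model over the tree's
  registers `QReg n = Fin n → Bool` and gate placement `placeGate` (`QubitRegister.lean`):
  `MixedState n` (operators on `n` qubits), `IsDensity`, `pauliY`, `conjBy`, `pauliTwirl`,
  `depolarizeWire p j` (`ρ ↦ (1 − p) ρ + p (I/2 ⊗ Tr_j ρ)`, written through the Pauli twirl
  identity `I/2 ⊗ Tr_j ρ = ¼ Σ_{P ∈ {I,X,Y,Z}} P_j ρ P_j`), `MixedUnitaryGate k` (finite
  probabilistic mixtures of `k`-qubit unitaries), `QubitChannel` (one-qubit CPTP maps in Kraus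
  form), `NoisyGate`/`NoisyLevel`/`NoisyCircuit` (levels = partitions of the wires into gate
  blocks, noise attached to the gates as in the source), `probOne` (probability of outcome `1` on
  the output qubit), `RatesAtLeast ε₁ εk`, `kruwThreshold k = 1 − √(2^{1/k} − 1)`.
* `kempeRegevUngerDeWolf2008_thm1` — Theorem 1 as printed (`2^{−Ω(T)}` rendered as
  `∃ c > 0, ∃ T₀, ∀ T ≥ T₀, … ≤ 2^{−cT}`, constants depending on `k, ε₁, ε_k` only).
* `NoiseThresholdUpperBounds` — the barrier decl (`:= kempeRegevUngerDeWolf2008_thm1`) carrying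
  the D-0021 block, and the proved reading `NoiseThresholdUpperBounds.eventually_no_gap`: beyond
  a depth `T₁(k, ε₁, ε_k)` no circuit of the model separates two input states with the
  bounded-error gap `(2/3, 1/3)`.
* Audit (2026-08-16, refuter barrier audit; append-only): `kruwIdleLevel`, `kruwIdleCircuit`,
  `qubitBasisDensity` and `kempeRegevUngerDeWolf2008_thm1_false_of_eps1_zero` — Theorem 1 with
  noise-exempt wires (`0 ≤ ε₁` for `0 < ε₁`) is FALSE (the paper's own remark), the formal reason
  the bound says nothing once a noiseless classical register is adjoined; and the proved theorem
  `NoiseThresholdUpperBoundsNarrow` carrying the NARROWED barrier block: (i), (ii) cover only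
  non-adaptive circuits with every register noisy; with noiseless classical control the printed
  bounds are the capacity bounds of Fawzi–Müller-Hermes–Shayeghi (ITCS 2022) and
  G–Nayak–Chatterjee (Quantum 2023) — which need noise on EVERY qubit at EVERY step — and the
  separability simulations of Harrow–Nielsen (2003) / Virmani–Huelga–Plenio (2005) at `≥ 2/3`
  per-qubit depolarizing on two-qubit gates; the window `(0.357, 2/3)` with perfect classical
  side-processing is not excluded by any printed theorem. The typed fact itself is unchanged (and
  is discharged in `NoiseThresholdUpperBoundsProofs.lean`).

## Design notes

* Finite mixtures of unitaries lose no generality (Carathéodory in the finite-dimensional space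
  of superoperators); one-qubit CPTP maps are exactly the maps with a Kraus representation
  `Σ Kᵢ† Kᵢ = 1` (Choi), so `QubitChannel` ranges over all of them.
* "At least `ε`-depolarizing noise" is rendered by letting every gate carry its own rate `p` with
  `ε ≤ p ≤ 1` (`RatesAtLeast`); gates in a level are applied in list order (they act on disjoint
  blocks).
* Mathlib/tree search: no density-matrix, CPTP, Kraus, partial-trace or depolarizing-channel
  vocabulary (`lean search 'Kraus|CPTP|partialTrace|DensityMatrix|depolariz'`: only the
  real-valued `depolarize` of `LinearXEBSpoofing.lean`); Pauli `X`, `Z` are Q2's `pauliX`,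
  `pauliZ`, `Y := i·X·Z`.

## References

* [KempeEtAl2010] J. Kempe, O. Regev, F. Unger, R. de Wolf, Quantum Inf. Comput. 10
  (2010) 361–376; arXiv:0802.1464 (read via `lit read paper:arxiv-0802.1464`): abstract, §1
  (model, Thm 1, significance, related work pp. 3–5), §3 (Lemma 7), §4 (CNOT, `29.3%`).
* [Razborov2004] A. A. Razborov, Quantum Inf. Comput. 4 (2004) 222–228; arXiv:quant-ph/0310136
  (read via `lit read paper:arxiv-quant-ph_0310136`): abstract, §1, Def. 2.3, Thm 2.4 (p. 4–5).
* [BuhrmanEtAl2006] H. Buhrman et al., FOCS 2006; arXiv:quant-ph/0604141 (read via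
  `lit read paper:arxiv-quant-ph_0604141`): abstract, §1 (p. 2–3), Thm 1 (p. 9), §5 (p. 10).
* [FawziMullerHermesShayeghi2022] O. Fawzi, A. Müller-Hermes, A. Shayeghi, *A lower bound on the
  space overhead of fault-tolerant quantum computation*, ITCS 2022 (LIPIcs 215, 68);
  arXiv:2202.00119v2 (read via `lit read arxiv:2202.00119`): abstract, §1 (p. 3: classical
  computation and control), §1.1 (model), §1.2 (Thm 1, Thm 2, depolarizing `p > 1/3`), §1.3
  (remarks on Razborov and Kempe et al.).
* [GNayakChatterjee2023] Uthirakalyani G, A. K. Nayak, A. Chatterjee, *A converse for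
  fault-tolerant quantum computation*, Quantum 7 (2023) 1087; arXiv:2211.00697 (read via
  `lit read arxiv:2211.00697`): §1.1–1.2, §2 (model: free noiseless classical computation, dummy
  identity gates noised), §3.2 (Cor. 2, Prop. 2).
* [HarrowNielsen2003] A. W. Harrow, M. A. Nielsen, *Robustness of quantum gates in the presence of
  noise*, Phys. Rev. A 68 (2003) 012308; arXiv:quant-ph/0301108 (read via
  `lit read arxiv:quant-ph/0301108`): §3.2 (separable-gate circuits are classically simulable),
  §5.1.2 (`p ≥ (8 − √8)/7 ≈ 0.74`), §5.2.2 (`p_th ≤ 1/2` for adversarial gate noise, `8/9`).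
* [VirmaniHuelgaPlenio2005] S. Virmani, S. F. Huelga, M. B. Plenio, *Classical simulability,
  entanglement breaking, and quantum computation thresholds*, Phys. Rev. A 71 (2005) 042328;
  arXiv:quant-ph/0408076 (read via `lit read arxiv:quant-ph/0408076`): abstract, bi-entangling
  machines (simulation algorithm), CNOT under individual depolarizing noise `p ≥ 2/3 ≈ 67%`.
* [PlenioVirmani2010] M. B. Plenio, S. Virmani, *Upper bounds on fault tolerance thresholds of
  noisy Clifford-based quantum computers*, New J. Phys. 12 (2010) 033012; arXiv:0810.4340 (read
  via `lit read arxiv:0810.4340`): abstract and §1 (`3.69%` error-per-gate for Knill's scheme;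
  'classical' versus 'quantum' approaches to upper bounds).
* [BenOrGottesmanHassidim2013] M. Ben-Or, D. Gottesman, A. Hassidim, *Quantum refrigerator*,
  arXiv:1301.1995 (read via `lit read arxiv:1301.1995`): abstract (three classes of channels:
  depolarizing-like — logarithmic time; dephasing-like — polynomial; amplitude-damping-like —
  exponential, without fresh ancillas); also summarised in [FawziMullerHermesShayeghi2022], §1.2.
-/

noncomputable section

open scoped ComplexOrder
open Matrix Finset Literature.Computability.Cryptography

namespace Literature.Barriers.QuantumAdvantage

/-! ### Mixed states on `n` qubits and single-qubit depolarizing noise -/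

/-- Operators on the `n`-qubit register (density matrices and their differences live here).
[cite: KempeEtAl2010, §2 (Preliminaries)] -/
abbrev MixedState (n : ℕ) : Type := Matrix (QReg n) (QReg n) ℂ

variable {n k : ℕ}

/-- Density matrices: positive semidefinite operators of trace one.
[cite: Razborov2004, §2 (D(𝒩))] -/
def IsDensity (ρ : MixedState n) : Prop :=
  ρ.PosSemidef ∧ ρ.trace = 1

/-- The embedding of the single wire `j` (for placing one-qubit operators with `placeGate`).
[folklore] -/
def wire (j : Fin n) : Fin 1 ↪ Fin n :=
  ⟨fun _ => j, fun a b _ => Subsingleton.elim a b⟩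

/-- `wire j` hits `j`. [folklore] -/
@[simp] theorem wire_apply (j : Fin n) (i : Fin 1) : wire j i = j := rfl

/-- The Pauli `Y = iXZ = [[0, −i], [i, 0]]` (Q2 provides `pauliX`, `pauliZ`).
[cite: KempeEtAl2010, §2 (Pauli matrices)] -/
def pauliY : Matrix (QReg 1) (QReg 1) ℂ :=
  Complex.I • (pauliX * pauliZ)

/-- Conjugation `ρ ↦ M ρ M†`. [folklore] -/
def conjBy (M ρ : MixedState n) : MixedState n :=
  M * ρ * Mᴴ

/-- Conjugating by the identity does nothing. [folklore] -/
@[simp] theorem conjBy_one (ρ : MixedState n) : conjBy 1 ρ = ρ := by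
  simp [conjBy]

/-- The uniform Pauli twirl of qubit `j`: `¼ Σ_{P ∈ {I,X,Y,Z}} P_j ρ P_j = (I/2) ⊗ Tr_j ρ`
(replace qubit `j` by the completely mixed state). [cite: KempeEtAl2010, §1 (p-depolarizing noise) and Observation 4] -/
def pauliTwirl (j : Fin n) (ρ : MixedState n) : MixedState n :=
  (1 / 4 : ℂ) • (ρ + conjBy (placeGate (wire j) pauliX) ρ + conjBy (placeGate (wire j) pauliY) ρ +
    conjBy (placeGate (wire j) pauliZ) ρ)

/-- **`p`-depolarizing noise on qubit `j`**: `𝓔(ρ) = (1 − p) ρ + p · (I/2 ⊗ Tr_j ρ)` — "replaces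
that qubit by the completely mixed state with probability `p`, and does not alter the qubit
otherwise". [cite: KempeEtAl2010, §1 (Our model: 𝓔(ρ) = (1−p)ρ + pI/2)] -/
def depolarizeWire (p : ℝ) (j : Fin n) (ρ : MixedState n) : MixedState n :=
  ((1 - p : ℝ) : ℂ) • ρ + (p : ℂ) • pauliTwirl j ρ

/-- Noise of strength `0` is the identity channel. [folklore] -/
@[simp] theorem depolarizeWire_zero (j : Fin n) (ρ : MixedState n) : depolarizeWire 0 j ρ = ρ := by
  simp [depolarizeWire]

/-- Independent `p`-depolarizing noise on each wire of a list (applied in order; the channels on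
distinct wires commute). [cite: KempeEtAl2010, §1 (noise on each input qubit)] -/
def depolarizeWires (p : ℝ) : List (Fin n) → MixedState n → MixedState n
  | [], ρ => ρ
  | j :: js, ρ => depolarizeWires p js (depolarizeWire p j ρ)

/-- No wires, no noise. [folklore] -/
@[simp] theorem depolarizeWires_nil (p : ℝ) (ρ : MixedState n) : depolarizeWires p [] ρ = ρ := rfl

/-! ### Gates of the Kempe–Regev–Unger–de Wolf model -/

/-- A `k`-qubit gate that is a (finite) **probabilistic mixture of unitaries**
`ρ ↦ Σᵢ wᵢ Uᵢ ρ Uᵢ†`, `wᵢ ≥ 0`, `Σ wᵢ = 1`, `Uᵢ ∈ U(2^k)`.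
[cite: KempeEtAl2010, §1 (Our model: k-qubit gates that are probabilistic mixtures of unitary operations)] -/
structure MixedUnitaryGate (k : ℕ) where
  /-- number of terms of the mixture -/
  r : ℕ
  /-- the probabilities -/
  weight : Fin r → ℝ
  /-- probabilities are nonnegative -/
  weight_nonneg : ∀ i, 0 ≤ weight i
  /-- probabilities sum to one -/
  sum_weight : ∑ i, weight i = 1
  /-- the unitaries -/
  unitary : Fin r → Matrix (QReg k) (QReg k) ℂ
  /-- each term is unitary -/
  unitary_mem : ∀ i, unitary i ∈ Matrix.unitaryGroup (QReg k) ℂ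

/-- Action of a mixed-unitary gate placed on the wires `e`. [cite: KempeEtAl2010, §1 (Our model)] -/
def MixedUnitaryGate.apply (G : MixedUnitaryGate k) (e : Fin k ↪ Fin n) (ρ : MixedState n) :
    MixedState n :=
  ∑ i, (G.weight i : ℂ) • conjBy (placeGate e (G.unitary i)) ρ

/-- An **arbitrary one-qubit gate**: a completely positive trace-preserving map on one qubit, in
Kraus form `ρ ↦ Σᵢ Kᵢ ρ Kᵢ†` with `Σᵢ Kᵢ† Kᵢ = 1` (this includes non-unitary operations such as
resetting the qubit to `|0⟩`, i.e. a source of fresh qubits).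
[cite: KempeEtAl2010, §1 (Our model: arbitrary one-qubit gates; significance of results)] -/
structure QubitChannel where
  /-- number of Kraus operators -/
  r : ℕ
  /-- the Kraus operators -/
  kraus : Fin r → Matrix (QReg 1) (QReg 1) ℂ
  /-- trace preservation -/
  sum_kraus : ∑ i, (kraus i)ᴴ * kraus i = 1

/-- The identity one-qubit gate (a single Kraus operator `1`). [folklore] -/
def QubitChannel.id : QubitChannel where
  r := 1
  kraus := fun _ => 1
  sum_kraus := by simp

/-- Action of a one-qubit channel placed on wire `j`. [cite: KempeEtAl2010, §1 (Our model)] -/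
def QubitChannel.apply (G : QubitChannel) (j : Fin n) (ρ : MixedState n) : MixedState n :=
  ∑ i, conjBy (placeGate (wire j) (G.kraus i)) ρ

/-- The identity channel acts as the identity (given Q2's fact `placeGate_one`). [folklore] -/
theorem QubitChannel.id_apply (j : Fin n) (ρ : MixedState n) : QubitChannel.id.apply j ρ = ρ := by
  simp [QubitChannel.apply, QubitChannel.id, placeGate_one]

/-- A gate of a level **with its noise attached** ("we think of the noise as being part of the
gate", §3): either a `k`-qubit mixed-unitary gate on the wires `e`, *preceded* by `p`-depolarizing
noise on each of its input wires, or a one-qubit channel on wire `j`, *followed* by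
`p`-depolarizing noise on its output wire. [cite: KempeEtAl2010, §1 (Our model) and §3] -/
inductive NoisyGate (n k : ℕ) : Type
  /-- `k`-qubit probabilistic mixture of unitaries on wires `e`, inputs hit by `p`-noise -/
  | mixedUnitary (e : Fin k ↪ Fin n) (G : MixedUnitaryGate k) (p : ℝ) : NoisyGate n k
  /-- arbitrary one-qubit gate on wire `j`, output hit by `p`-noise -/
  | qubit (j : Fin n) (G : QubitChannel) (p : ℝ) : NoisyGate n k

namespace NoisyGate

/-- The block of wires a gate acts on. [cite: KempeEtAl2010, §1 (each level is a partition of the qubits)] -/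
def wires : NoisyGate n k → Finset (Fin n)
  | mixedUnitary e _ _ => Finset.univ.map e
  | qubit j _ _ => {j}

/-- Semantics of a noisy gate on mixed states. [cite: KempeEtAl2010, §1 (Our model)] -/
def apply : NoisyGate n k → MixedState n → MixedState n
  | mixedUnitary e G p, ρ => G.apply e (depolarizeWires p ((List.finRange k).map e) ρ)
  | qubit j G p, ρ => depolarizeWire p j (G.apply j ρ)

/-- The noise-rate constraint of the model: `k`-qubit gates carry at least `εk`-noise, one-qubit
gates at least `ε₁`-noise (rates are probabilities, `≤ 1`).
[cite: KempeEtAl2010, §1 (at least ε₁- / ε_k-depolarizing noise)] -/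
def RateAtLeast (ε₁ εk : ℝ) : NoisyGate n k → Prop
  | mixedUnitary _ _ p => εk ≤ p ∧ p ≤ 1
  | qubit _ _ p => ε₁ ≤ p ∧ p ≤ 1

end NoisyGate

/-- A **level**: gates on pairwise disjoint blocks of wires covering every wire ("at each level,
all qubits must go through some gate (possibly the identity)").
[cite: KempeEtAl2010, §1 (Our model: parallel circuits, levels)] -/
structure NoisyLevel (n k : ℕ) where
  /-- the gates of the level -/
  gates : List (NoisyGate n k)
  /-- blocks are disjoint -/
  disjoint : gates.Pairwise fun a b => Disjoint a.wires b.wires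
  /-- blocks cover all wires -/
  cover : ∀ j : Fin n, ∃ g ∈ gates, j ∈ g.wires

/-- Semantics of a level (gates applied in list order; they act on disjoint blocks).
[cite: KempeEtAl2010, §1 (Our model)] -/
def NoisyLevel.apply (L : NoisyLevel n k) (ρ : MixedState n) : MixedState n :=
  L.gates.foldl (fun σ g => g.apply σ) ρ

/-- A `T`-level noisy circuit on `n` wires with `k`-qubit gates and a designated output qubit.
[cite: KempeEtAl2010, §1 (Our model)] -/
structure NoisyCircuit (n k : ℕ) where
  /-- the levels, in temporal order -/
  levels : List (NoisyLevel n k)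
  /-- the designated output qubit -/
  out : Fin n

namespace NoisyCircuit

/-- The number of levels `T`. [cite: KempeEtAl2010, §1 (T levels)] -/
def depth (C : NoisyCircuit n k) : ℕ :=
  C.levels.length

/-- The final state on initial state `ρ`. [cite: KempeEtAl2010, §1 (Our model)] -/
def run (C : NoisyCircuit n k) (ρ : MixedState n) : MixedState n :=
  C.levels.foldl (fun σ L => L.apply σ) ρ

/-- A circuit without levels does nothing. [folklore] -/
@[simp] theorem run_nil (out : Fin n) (ρ : MixedState n) :
    (⟨[], out⟩ : NoisyCircuit n k).run ρ = ρ := rfl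

/-- The probability of measurement outcome `1` on the output qubit:
`Tr(Π₁^{out} C(ρ)) = Σ_{x : x_out = 1} C(ρ)_{xx}`.
[cite: KempeEtAl2010, §1 (measuring a designated output qubit) and Observation 5] -/
def probOne (C : NoisyCircuit n k) (ρ : MixedState n) : ℝ :=
  (∑ x ∈ Finset.univ.filter (fun x : QReg n => x C.out = true), C.run ρ x x).re

/-- Every gate of the circuit satisfies the model's noise-rate constraint.
[cite: KempeEtAl2010, §1 (Our model)] -/
def RatesAtLeast (ε₁ εk : ℝ) (C : NoisyCircuit n k) : Prop :=
  ∀ L ∈ C.levels, ∀ g ∈ L.gates, g.RateAtLeast ε₁ εk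

end NoisyCircuit

/-- The Kempe–Regev–Unger–de Wolf bound `1 − √(2^{1/k} − 1) = 1 − Θ(1/√k)` on the noise rate of
`k`-qubit gates (`≈ 35.7%` for `k = 2`). [cite: KempeEtAl2010, §1 (ε_k > 1 − √(2^{1/k} − 1))] -/
def kruwThreshold (k : ℕ) : ℝ :=
  1 - Real.sqrt ((2 : ℝ) ^ (1 / (k : ℝ)) - 1)

/-- For one-qubit "multi-qubit" gates the bound degenerates to `0`. [folklore] -/
@[simp] theorem kruwThreshold_one : kruwThreshold 1 = 0 := by
  norm_num [kruwThreshold]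

/-! ### Kempe–Regev–Unger–de Wolf 2008, Theorem 1 -/

/-- **Kempe–Regev–Unger–de Wolf, Theorem 1.** Source: "Fix any `T`-level quantum circuit as
above. Then for any two states `ρ` and `τ`, the probabilities of obtaining measurement outcome `1`
at the output qubit starting from `ρ` and starting from `τ`, respectively, differ by at most
`2^{−Ω(T)}`", the model being: `k`-qubit gates that are probabilistic mixtures of unitaries, each
preceded by at least `ε_k`-depolarizing noise on each input qubit, `ε_k > 1 − √(2^{1/k} − 1)`;
arbitrary one-qubit gates each followed by at least `ε₁`-depolarizing noise, `ε₁ > 0`; the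
constant in `Ω(·)` depends on `k, ε₁, ε_k` only (Lemma 7: `θ = θ(ε₁, ε_k, k) < 1` with
`Tr δ_V² ≤ 2 θ^{dist(V)}` for every circuit). Rendering of `2^{−Ω(T)}`: there are `c > 0` and `T₀`
such that every circuit of the model with `T ≥ T₀` levels satisfies the bound `2^{−cT}` (the
proof gives `θ^{T/2}` for all `T`). [cite: KempeEtAl2010, Thm 1 (with §1 Our model and Lemma 7)] -/
def kempeRegevUngerDeWolf2008_thm1 : Prop :=
  ∀ (k : ℕ) (ε₁ εk : ℝ), 1 ≤ k → 0 < ε₁ → kruwThreshold k < εk →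
    ∃ c : ℝ, 0 < c ∧ ∃ T₀ : ℕ, ∀ (n : ℕ) (C : NoisyCircuit n k),
      C.RatesAtLeast ε₁ εk → T₀ ≤ C.depth →
        ∀ ρ τ : MixedState n, IsDensity ρ → IsDensity τ →
          |C.probOne ρ - C.probOne τ| ≤ (2 : ℝ) ^ (-(c * (C.depth : ℝ)))

/-! ### The barrier -/

/-- **Upper bounds on the fault-tolerance threshold** (the catalogue decl; definitionally
`kempeRegevUngerDeWolf2008_thm1`).

BARRIER
technique_class: fault-tolerance, quantum-error-correction, threshold-theorem, concatenated-codes, magic-state-distillation, noisy-circuits, depolarizing-noise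
blocks: the evasion "fault tolerance" of `Literature.Barriers.QuantumAdvantage.UncorrectedNoise` at physical noise rates above explicit constants, hence any witness of the summit `QuantumAdvantage` (or of sampling/finite-experiment proxies) by devices that noisy: (i) in the Kempe–Regev–Unger–de Wolf model with `ε_k > 1 − √(2^{1/k} − 1)` (`35.7%` for `k = 2`; `29.3%` if CNOT is the only two-qubit gate) the output bit of ANY circuit — including circuits acting on inputs encoded in a quantum error-correcting code or supplied with magic states — is `2^{−Ω(T)}`-close to input-independent (`kempeRegevUngerDeWolf2008_thm1`, typed), so beyond a depth `T₁(k, ε₁, ε_k)` no circuit separates two input states with gap `(2/3, 1/3)` (`NoiseThresholdUpperBounds.eventually_no_gap`, proved from the fact) [cite: KempeEtAl2010, Thm 1, §1 (significance of results) and §4]; (ii) with arbitrary fan-in-`≤ k` quantum operations and `η`-depolarization of every qubit after every level, `η > 1 − 1/k` makes every circuit of depth `≥ C log(width)` practically worthless (trace distance `≤ 1/100` between the final states of any two inputs), so "no Boolean function `f ∈ QP ∖ QNC¹` can be computed fault-tolerantly" and the threshold satisfies `η₀ ≤ 1/2` for fan-in `2` [cite: Razborov2004, Thm 2.4 and Def.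 2.3]; (iii) perfect Clifford operations plus one-qubit gates with depolarizing noise `> (6 − 2√2)/7 ≈ 45.3%` and one single-qubit measurement are "not sufficient for arbitrary classical computation" [cite: BuhrmanEtAl2006, Thm 1].
because: depolarizing noise of strength `p` shrinks every Pauli coefficient supported on the noisy qubit by `1 − p` while unitaries only redistribute the sum of squares of Pauli coefficients and one-qubit CPTP maps are controlled by the Ruskai–Szarek–Werner normal form; for `ε_k` above the bound the invariant `Tr δ_V² ≤ 2 θ^{dist(V)}` (`θ < 1`, `δ = ρ − τ`) propagates through every consistent set of qubits, giving `|δ̂(Z)| ≤ 2 θ^{T/2}` at the output [cite: KempeEtAl2010, §3 (Lemma 7, Lemma 8)]; Razborov tracks the trace distance of all `≤ m`-qubit marginals through the recursion `𝓔_η^{⊗}(ρ|_B) = Σ_{A ⊆ B} η^{|B|−|A|}(1−η)^{|A|} ρ|_A ⊗ (I/2)^{⊗}` and contractivity of quantum operations [cite: Razborov2004, §3]; Buhrman et al. show a one-qubit unitary followed by `≥ 45.3%` depolarizing noise is a probabilistic mixture of Clifford operations, and Clifford circuits on distributed inputs need at most one bit of communication [cite: BuhrmanEtAl2006, §1 and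 Lemmas 1–3].
evasions_known: noise BELOW threshold: fault-tolerance schemes exist for all noise rates under a positive constant (threshold theorem; provable thresholds of order `0.1%`, numerical estimates above `1%` for Knill's schemes), leaving "about two orders of magnitude between our best upper and lower bounds" [cite: KempeEtAl2010, §1 (pp. 2–3)]; with perfect stabilizer operations AND classical control, one-qubit gates with LESS than `45.3%` noise regain universality by magic-state distillation, so bound (iii) is tight in its model [cite: BuhrmanEtAl2006, §5] [cite: KempeEtAl2010, §1 (footnote on the 45.3% bound)]; a supply of fresh qubits is necessary for any constant noise rate and is granted in all three models [cite: Razborov2004, §1 and Remark 2] [cite: KempeEtAl2010, §1 (significance of results)].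
scope_caveats: the three models are pairwise incomparable (where the noise sits, which gates are noisy, what "useless" means) and none is claimed to be the realistic one [cite: KempeEtAl2010, §1 (related work, p. 5)] [cite: BuhrmanEtAl2006, §1 (p. 3)]; only (i) is typed here, over this file's rendering of the model (finite unitary mixtures of arity exactly `k`, Kraus-form one-qubit channels, per-gate rates `ε ≤ p ≤ 1`, gates of a level applied in list order), and its conclusion is input-independence of ONE output qubit, not a classical simulation and not a statement about many-qubit outputs ("can be easily extended" to a small number of output qubits is asserted without proof) [cite: KempeEtAl2010, §1 (significance of results)]; (ii)'s constant `C` and (i)'s `Ω` are not made explicit in print; nothing here bounds the true threshold from below or says anything for noise under `29.3%`; the suggestion that depolarizing noise `> 1/3` already kills quantum advantage (no-cloning bound) is explicitly unproved [cite: KempeEtAl2010, §1 (end of related work)]. AUDIT 2026-08-16 (NARROWED — see `NoiseThresholdUpperBoundsNarrow` for the corrected block): (i) and (ii) are proved only for NON-ADAPTIVE circuits in which EVERY register, including any wire holding syndromes or other classical data, suffers the model's noise at every level — no noiseless classical memory and no conditioning of later gates on earlier measurement outcomes [cite: KempeEtAl2010, §1 (Our model; Related work, footnote: "if one additionally allows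 perfect classical control")] [cite: FawziMullerHermesShayeghi2022, §1 (p. 3) and §1.3 ("their model does not allow noiseless classical computation and classically controlled operations")]; with noise-exempt wires the conclusion of (i) is false at every depth (`kempeRegevUngerDeWolf2008_thm1_false_of_eps1_zero`), so the technique classes "fault-tolerance / threshold-theorem / magic-state-distillation" are covered here only in their measurement-free form ((i), (ii)) or with perfect Clifford gates ((iii)); the bounds that hold WITH noiseless classical control are listed in the narrowed block [cite: FawziMullerHermesShayeghi2022, Thm 2] [cite: GNayakChatterjee2023, Prop. 2] [cite: HarrowNielsen2003, §5.1.2] [cite: VirmaniHuelgaPlenio2005, abstract].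
status: established (theorems in print; (i) typed as a named fact, its decision-gap reading proved here) [cite: KempeEtAl2010, Thm 1] [cite: Razborov2004, Thm 2.4] [cite: BuhrmanEtAl2006, Thm 1] -/
def NoiseThresholdUpperBounds : Prop :=
  kempeRegevUngerDeWolf2008_thm1

/-- The catalogue decl is the typed theorem (definitional). [folklore] -/
theorem noiseThresholdUpperBounds_iff :
    NoiseThresholdUpperBounds ↔ kempeRegevUngerDeWolf2008_thm1 :=
  Iff.rfl

/-- **Decision-gap reading** ("renders long computations essentially useless"): granted Theorem 1,
for every admissible `k, ε₁, ε_k` there is a depth `T₁` beyond which no circuit of the model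
accepts one input state with probability `≥ 2/3` while accepting another with probability
`≤ 1/3` — so a bounded-error decision procedure whose input enters as the initial state (in any
encoding) must have depth `< T₁`, a constant independent of the number of qubits.
[cite: KempeEtAl2010, Thm 1 and §1 ("making the circuit useless")] -/
theorem NoiseThresholdUpperBounds.eventually_no_gap (h : NoiseThresholdUpperBounds) {k : ℕ}
    {ε₁ εk : ℝ} (hk : 1 ≤ k) (hε₁ : 0 < ε₁) (hεk : kruwThreshold k < εk) :
    ∃ T₁ : ℕ, ∀ (n : ℕ) (C : NoisyCircuit n k), C.RatesAtLeast ε₁ εk → T₁ ≤ C.depth →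
      ∀ ρ τ : MixedState n, IsDensity ρ → IsDensity τ →
        ¬ (2 / 3 ≤ C.probOne ρ ∧ C.probOne τ ≤ 1 / 3) := by
  obtain ⟨c, hc, T₀, hT⟩ := h k ε₁ εk hk hε₁ hεk
  refine ⟨max T₀ (⌈2 / c⌉₊ + 1), fun n C hR hd ρ τ hρ hτ hgap => ?_⟩
  have hT₀ : T₀ ≤ C.depth := le_trans (le_max_left _ _) hd
  have hbound := hT n C hR hT₀ ρ τ hρ hτ
  -- the depth is large enough that `2^{-c·T} < 1/3`
  have hd' : (⌈2 / c⌉₊ + 1 : ℝ) ≤ (C.depth : ℝ) := by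
    have : ⌈2 / c⌉₊ + 1 ≤ C.depth := le_trans (le_max_right _ _) hd
    exact_mod_cast this
  have hceil : 2 / c ≤ (⌈2 / c⌉₊ : ℝ) := Nat.le_ceil _
  have hcT : 2 < c * (C.depth : ℝ) := by
    have h1 : c * (2 / c) = 2 := by field_simp
    nlinarith
  have hpow : (2 : ℝ) ^ (-(c * (C.depth : ℝ))) < (2 : ℝ) ^ (-(2 : ℝ)) :=
    Real.rpow_lt_rpow_of_exponent_lt (by norm_num) (by linarith)
  have hquarter : (2 : ℝ) ^ (-(2 : ℝ)) = 1 / 4 := by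
    rw [Real.rpow_neg (by norm_num), show (2 : ℝ) = ((2 : ℕ) : ℝ) by norm_num,
      Real.rpow_natCast]
    norm_num
  have hlt : |C.probOne ρ - C.probOne τ| < 1 / 3 := by
    calc |C.probOne ρ - C.probOne τ| ≤ (2 : ℝ) ^ (-(c * (C.depth : ℝ))) := hbound
      _ < (2 : ℝ) ^ (-(2 : ℝ)) := hpow
      _ = 1 / 4 := hquarter
      _ < 1 / 3 := by norm_num
  have hge : 1 / 3 ≤ C.probOne ρ - C.probOne τ := by linarith [hgap.1, hgap.2]
  exact absurd (lt_of_le_of_lt (le_abs_self _) hlt) (not_lt.mpr hge)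

/-! ### Audit 2026-08-16 (refuter barrier audit, append-only): noise-exempt wires and the narrowed block

The typed fact above is faithful to the printed Theorem 1 and is discharged in
`NoiseThresholdUpperBoundsProofs.lean`; what the audit corrects is the SCOPE claimed by the
barrier block. The formal edge of Theorem 1 is the hypothesis `ε₁ > 0` — every wire is noisy at
every level. Dropping it (noise-exempt wires, which is what a perfect classical register is) makes
the statement false at every depth; this is the paper's own remark and the reason bounds (i) and
(ii) do not speak about fault tolerance with noiseless classical control. -/

/-- The level consisting of the noise-free identity one-qubit gate on the single wire (admissible
iff `ε₁ = 0`). [cite: KempeEtAl2010, §1 (Significance of results: "apply noise-free one-qubit identity gates on all wires")] -/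
def kruwIdleLevel : NoisyLevel 1 1 where
  gates := [NoisyGate.qubit 0 QubitChannel.id 0]
  disjoint := List.pairwise_singleton _ _
  cover j := ⟨NoisyGate.qubit 0 QubitChannel.id 0, by simp, by
    simp [NoisyGate.wires, Subsingleton.elim j 0]⟩

/-- `T` levels of noise-free identity gates on one wire ("do nothing for `T` levels"), output =
that wire. [cite: KempeEtAl2010, §1 (Significance of results)] -/
def kruwIdleCircuit (T : ℕ) : NoisyCircuit 1 1 where
  levels := List.replicate T kruwIdleLevel
  out := 0

/-- A noise-free identity level acts as the identity. [folklore] -/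
theorem kruwIdleLevel_apply (ρ : MixedState 1) : kruwIdleLevel.apply ρ = ρ := by
  simp [NoisyLevel.apply, kruwIdleLevel, NoisyGate.apply, QubitChannel.id_apply]

/-- The idle circuit acts as the identity on states. [folklore] -/
theorem kruwIdleCircuit_run (T : ℕ) (ρ : MixedState 1) : (kruwIdleCircuit T).run ρ = ρ := by
  induction T with
  | zero => rfl
  | succ T ih =>
    simp only [NoisyCircuit.run, kruwIdleCircuit, List.replicate_succ, List.foldl_cons,
      kruwIdleLevel_apply] at ih ⊢
    exact ih

/-- The idle circuit has depth `T`. [folklore] -/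
@[simp] theorem kruwIdleCircuit_depth (T : ℕ) : (kruwIdleCircuit T).depth = T := by
  simp [NoisyCircuit.depth, kruwIdleCircuit]

/-- With `ε₁ = 0` the idle circuit satisfies the model's rate constraint (its only gates are
one-qubit gates with noise rate `0`). [cite: KempeEtAl2010, §1 (Our model)] -/
theorem kruwIdleCircuit_ratesAtLeast (T : ℕ) (εk : ℝ) : (kruwIdleCircuit T).RatesAtLeast 0 εk := by
  intro L hL g hg
  simp only [kruwIdleCircuit, List.mem_replicate] at hL
  obtain ⟨-, rfl⟩ := hL
  simp only [kruwIdleLevel, List.mem_singleton] at hg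
  subst hg
  exact ⟨le_rfl, zero_le_one⟩

/-- The computational basis state `|b⟩⟨b|` of one qubit, as a diagonal matrix. [folklore] -/
def qubitBasisDensity (b : Bool) : MixedState 1 :=
  Matrix.diagonal fun x => if x 0 = b then 1 else 0

/-- `|b⟩⟨b|` is a density matrix. [folklore] -/
theorem isDensity_qubitBasisDensity (b : Bool) : IsDensity (qubitBasisDensity b) := by
  refine ⟨Matrix.PosSemidef.diagonal fun x => ?_, ?_⟩
  · by_cases h : x 0 = b <;> simp [h]
  · rw [qubitBasisDensity, Matrix.trace_diagonal,
      Fintype.sum_eq_add (fun _ => true) (fun _ => false) ?_ ?_]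
    · cases b <;> simp
    · intro h
      have := congrFun h 0
      simp at this
    · rintro x ⟨h1, h2⟩
      exfalso
      have hx : x = fun _ => x 0 := funext fun i => by rw [Subsingleton.elim i 0]
      cases hx0 : x 0
      · exact h2 (hx.trans (funext fun _ => hx0))
      · exact h1 (hx.trans (funext fun _ => hx0))

/-- The idle circuit outputs `b` with certainty on `|b⟩⟨b|`, at every depth. [cite: KempeEtAl2010, §1 (Significance of results)] -/
theorem probOne_kruwIdleCircuit (T : ℕ) (b : Bool) :
    (kruwIdleCircuit T).probOne (qubitBasisDensity b) = if b then 1 else 0 := by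
  simp only [NoisyCircuit.probOne, kruwIdleCircuit_run]
  have hout : (kruwIdleCircuit T).out = 0 := rfl
  rw [hout, Finset.sum_filter, Fintype.sum_eq_single (fun _ : Fin 1 => true)]
  · cases b <;> simp [qubitBasisDensity]
  · intro x hx
    have hx' : x 0 ≠ true := fun h0 =>
      hx ((funext fun i => by rw [Subsingleton.elim i 0] : x = fun _ => x 0).trans
        (funext fun _ => h0))
    simp [hx']

/-- **Theorem 1 is false for noise-exempt wires (`ε₁ = 0`).** Kempe–Regev–Unger–de Wolf: "`ε₁ > 0`
is only necessary because otherwise it would be possible to let `ρ := |0⟩⟨0| ⊗ ρ'` and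
`τ := |1⟩⟨1| ⊗ τ'`, do nothing for `T` levels (i.e., apply noise-free one-qubit identity gates on
all wires) and then measure the first qubit. The resulting difference between output probabilities
is then `1`." Formally: the statement of `kempeRegevUngerDeWolf2008_thm1` with `0 ≤ ε₁` in place of
`0 < ε₁` is false — witness `k = 1`, `ε₁ = 0`, `ε_k = 1`, one wire, `T₀ + 1` identity levels
(`kruwIdleCircuit`), `ρ = |1⟩⟨1|`, `τ = |0⟩⟨0|`, gap `1 > 2^{−c(T₀+1)}`. A perfect classical register is
precisely a wire exempt from noise (restricted to diagonal states), so this is also why no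
input-independence statement of type (i) survives the adjunction of noiseless classical memory
and control (`NoiseThresholdUpperBoundsNarrow`). [cite: KempeEtAl2010, §1 (Significance of results)] -/
theorem kempeRegevUngerDeWolf2008_thm1_false_of_eps1_zero :
    ¬ ∀ (k : ℕ) (ε₁ εk : ℝ), 1 ≤ k → 0 ≤ ε₁ → kruwThreshold k < εk →
      ∃ c : ℝ, 0 < c ∧ ∃ T₀ : ℕ, ∀ (n : ℕ) (C : NoisyCircuit n k),
        C.RatesAtLeast ε₁ εk → T₀ ≤ C.depth →
          ∀ ρ τ : MixedState n, IsDensity ρ → IsDensity τ →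
            |C.probOne ρ - C.probOne τ| ≤ (2 : ℝ) ^ (-(c * (C.depth : ℝ))) := by
  intro h
  obtain ⟨c, hc, T₀, hT⟩ := h 1 0 1 le_rfl le_rfl (by simp)
  have key := hT 1 (kruwIdleCircuit (T₀ + 1)) (kruwIdleCircuit_ratesAtLeast _ _)
    (by rw [kruwIdleCircuit_depth]; exact Nat.le_succ _) (qubitBasisDensity true) (qubitBasisDensity false)
    (isDensity_qubitBasisDensity _) (isDensity_qubitBasisDensity _)
  rw [probOne_kruwIdleCircuit, probOne_kruwIdleCircuit, kruwIdleCircuit_depth] at key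
  simp only [if_true] at key
  have hlt : (2 : ℝ) ^ (-(c * ((T₀ : ℝ) + 1))) < 1 :=
    Real.rpow_lt_one_of_one_lt_of_neg one_lt_two (by
      have : (0 : ℝ) ≤ (T₀ : ℝ) := by positivity
      nlinarith)
  norm_num at key
  exact absurd key (not_le.mpr hlt)

/-- **NARROWED BARRIER `NoiseThresholdUpperBoundsNarrow`** (barrier audit of
`NoiseThresholdUpperBounds`, refuter, 2026-08-16; a proved THEOREM, no new named fact — D-0026).
The audit read Kempe–Regev–Unger–de Wolf, Razborov and Buhrman et al. at page level, found the
typed fact `kempeRegevUngerDeWolf2008_thm1` faithful (model of §1 p. 4; Lemma 7's invariant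
`Tr δ_V² ≤ 2θ^{dist(V)}` with `θ = θ(k, ε₁, ε_k)`, no dependence on `n`; `|Δ| ≤ θ^{T/2}` for all
`T`) and could not break it (it is in fact discharged in `NoiseThresholdUpperBoundsProofs.lean`),
but found the entry's `technique_class` / `blocks` wording broader than the sources support in one
load-bearing respect — ADAPTIVITY / noiseless classical control — and silent on the post-2021
bounds that do allow it. Conjunct (1) is what (i) gives (the entry's decision-gap reading, from
the fact); conjunct (2) is where (i) stops: the same statement with noise-exempt wires is false
(`kempeRegevUngerDeWolf2008_thm1_false_of_eps1_zero`).

BARRIER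
technique_class: measurement-free-fault-tolerance, coherent-error-correction, non-adaptive-noisy-circuits, all-registers-noisy, depolarizing-noise, magic-states-as-input-states; (for adaptive threshold-theorem schemes and magic-state-distillation only clause (iii), perfect Cliffords, applies)
blocks: exactly what (i)–(iii) of `NoiseThresholdUpperBounds` print, with the models explicit: (i) [Kempe–Regev–Unger–de Wolf] and (ii) [Razborov] are about circuits whose gate sequence is FIXED IN ADVANCE, whose only measurement is the final one, and in which EVERY register — including any wire that would hold syndromes, flags or other classical data — suffers the model's depolarizing noise at every level; for those, above `ε_k > 1 − √(2^{1/k} − 1)` on the inputs of `k`-qubit gates (resp. `η > 1 − 1/k` on all qubits after every level) no code, concatenation or coherent (measurement-free) error correction keeps one output bit input-dependent beyond constant (resp. `C log n`) depth — conjunct (1) [cite: KempeEtAl2010, §1 (Our model) and Thm 1] [cite: Razborov2004, §2 (eqs. (3)–(5)) and Thm 2.4]; measurement-free fault tolerance is expressible there ("all known fault-tolerant constructions can be implemented using such gates") and magic states may be supplied as INPUT states [cite: KempeEtAl2010, §1 (Significance of results)]; (iii) [Buhrman et al.] assumes PERFECT stabilizer operations and bounds only the depolarizing noise (`> (6 −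 2√2)/7 ≈ 45.3%`) on the extra one-qubit gates, and it does survive classical co-processing, as a Gottesman–Knill simulation [cite: BuhrmanEtAl2006, §1 (p. 2) and §5]. Hence a witness of quantum advantage by a noisy device is blocked by this entry only if the device is non-adaptive with all registers noisy ((i), (ii)) or has noiseless Clifford gates ((iii)).
because: (1) is `NoiseThresholdUpperBounds.eventually_no_gap` (Pauli-mass decay, [cite: KempeEtAl2010, §3 (Lemma 7, Lemma 8)]); (2): with `ε₁ = 0` the one-wire circuit of noise-free identity gates separates `|1⟩⟨1|` from `|0⟩⟨0|` with gap `1` at every depth [cite: KempeEtAl2010, §1 (Significance of results)]; a perfect classical register is such a noise-exempt wire, so in any model with noiseless classical memory "one can imagine a circuit in which part of the input is measured in the first step, stored, and then output at the end ... for arbitrarily large values of `T` this circuit is not useless" [cite: FawziMullerHermesShayeghi2022, §1.3]; "Similar to Razborov's, their [Kempe et al.'s] model does not allow noiseless classical computation and classically controlled operations", and such results "do not incorporate the aid of noiseless classical computation and the adaptivity achieved through classical control ... Therefore, these results are not directly applicable to the fault tolerance schemes which rely on perfect classical computation and control" [cite: FawziMullerHermesShayeghi2022, §1 (p. 3) and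 §1.3]; Kempe et al. themselves name "perfect classical control" only as the extra resource under which (iii) becomes tight [cite: KempeEtAl2010, §1 (Related work, footnote)].
evasions_known: NOISELESS CLASSICAL CONTROL (intermediate measurements, feed-forward, perfect classical decoding — the setting of the threshold theorems with measurement and of magic-state distillation): (i) and (ii) do not apply [cite: FawziMullerHermesShayeghi2022, §1 (p. 3)]; the printed bounds that DO hold there are of two kinds. (a) Capacity bounds, for i.i.d. noise `𝒩` on EVERY qubit at EVERY time step, arbitrary CPTP gates of any fan-in controlled by a perfect classical register, fresh qubits allowed: fault tolerance is impossible when `Q(𝒩) = 0` — depolarizing `𝒩(ρ) = (1 − p)ρ + p I/2` with `p > 1/3` — and otherwise needs `≥ max{Q(𝒩)^{-1} n, α_𝒩 log T}` physical qubits [cite: FawziMullerHermesShayeghi2022, Thm 1 and Thm 2 (§1.2)]; with gates of size `g` (idle qubits pass through noisy identity gates) `ε`-accurate computation needs exponential space wherever `I_c(𝒩^{⊗g}) = 0`, a strictly larger region than `Q(𝒩) = 0` for non-degradable noise such as depolarizing [cite: GNayakChatterjee2023, §2 and Prop. 2]. (b) Simulation bounds (a classical sampler follows product-state trajectories, whatever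 the gates): two-qubit gates followed by independent depolarizing noise `p ≥ (8 − √8)/7 ≈ 0.74` on each output qubit are separability-preserving and circuits of such gates with product inputs are classically simulable [cite: HarrowNielsen2003, §3.2 and §5.1.2]; for CNOT the same noise with `p ≥ 2/3` makes the gate bi-entangling, again simulable [cite: VirmaniHuelgaPlenio2005, abstract and bi-entangling machines (CNOT, `p ≥ 2/3`)]; scheme-specific Clifford-commutation bounds reach `3.69%` error-per-gate for Knill's teleportation-based proposal with `XY`-plane states [cite: PlenioVirmani2010, abstract and §1]. NON-DEPOLARIZING NOISE behaves differently (dephasing-like versus non-unital channels; amplitude-damping-like noise even supplies fresh ancillas and allows exponentially long computations without them) [cite: FawziMullerHermesShayeghi2022, §1.2 (related work on Ben-Or–Gottesman–Hassidim)] [cite: BenOrGottesmanHassidim2013, abstract].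
scope_caveats: THE OPEN WINDOW. In Kempe et al.'s own regime — essentially noise-free one-qubit gates and storage (`ε₁ → 0`), `k = 2`, per-input depolarizing `ε₂` on two-qubit gates — but WITH noiseless classical control, no printed theorem excludes fault-tolerant quantum computation (or a decision-problem advantage) for `ε₂ ∈ (0.357, 2/3)` (CNOT-only gate sets: `(0.293, 2/3)`): the capacity bounds (a) need zero-capacity noise on every qubit at every step and are void when storage noise is small (`Q > 0`), and the simulation bounds (b) start at `2/3`; conversely no scheme is known to work anywhere near such rates (provable thresholds `~0.1%`, numerical `> 1%`, "about two orders of magnitude between our best upper and lower bounds") [cite: KempeEtAl2010, §1 (pp. 2–3)]. By conjunct (2) no input-independence statement of type (i) can close the window; a bound from above must be a SIMULATION or CAPACITY statement for adaptive circuits. Further: (i) concerns ONE output qubit ("a small number of output qubits" asserted without proof) [cite: KempeEtAl2010, §1 (Significance of results)]; (ii) needs depth `≥ C log(width)` for many-qubit outputs [cite: Razborov2004, Thm 2.4]; the simulation bounds (b) are printed for noise AFTER the gate, whereas (i) puts it BEFORE — for that placement `p ≥ 2/3` makes each input pass an entanglement-breaking channel first (`(1 − p)Φ⁺ + p I/4`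 is separable iff `p ≥ 2/3`), so a two-qubit gate then creates at most fresh two-qubit entanglement, the bi-entangling situation of [VirmaniHuelgaPlenio2005] (our reading; not printed for this placement); none of the numbers transfers between noise types.
status: established-narrowed (typed fact unchanged, unrefuted and discharged; (1) proved from it, (2) proved outright; block corrected by the audit) [cite: KempeEtAl2010, Thm 1] [cite: FawziMullerHermesShayeghi2022, Thm 2] -/
theorem NoiseThresholdUpperBoundsNarrow :
    (NoiseThresholdUpperBounds →
      ∀ (k : ℕ) (ε₁ εk : ℝ), 1 ≤ k → 0 < ε₁ → kruwThreshold k < εk →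
        ∃ T₁ : ℕ, ∀ (n : ℕ) (C : NoisyCircuit n k), C.RatesAtLeast ε₁ εk → T₁ ≤ C.depth →
          ∀ ρ τ : MixedState n, IsDensity ρ → IsDensity τ →
            ¬ (2 / 3 ≤ C.probOne ρ ∧ C.probOne τ ≤ 1 / 3)) ∧
    ¬ (∀ (k : ℕ) (ε₁ εk : ℝ), 1 ≤ k → 0 ≤ ε₁ → kruwThreshold k < εk →
      ∃ c : ℝ, 0 < c ∧ ∃ T₀ : ℕ, ∀ (n : ℕ) (C : NoisyCircuit n k),
        C.RatesAtLeast ε₁ εk → T₀ ≤ C.depth →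
          ∀ ρ τ : MixedState n, IsDensity ρ → IsDensity τ →
            |C.probOne ρ - C.probOne τ| ≤ (2 : ℝ) ^ (-(c * (C.depth : ℝ)))) :=
  ⟨fun h _ _ _ hk hε₁ hεk => h.eventually_no_gap hk hε₁ hεk,
    kempeRegevUngerDeWolf2008_thm1_false_of_eps1_zero⟩

/-- The two halves of the narrowed barrier, separately: what (i) gives … [cite: KempeEtAl2010, Thm 1] -/
theorem NoiseThresholdUpperBoundsNarrow.no_gap (h : NoiseThresholdUpperBounds) {k : ℕ} {ε₁ εk : ℝ}
    (hk : 1 ≤ k) (hε₁ : 0 < ε₁) (hεk : kruwThreshold k < εk) :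
    ∃ T₁ : ℕ, ∀ (n : ℕ) (C : NoisyCircuit n k), C.RatesAtLeast ε₁ εk → T₁ ≤ C.depth →
      ∀ ρ τ : MixedState n, IsDensity ρ → IsDensity τ →
        ¬ (2 / 3 ≤ C.probOne ρ ∧ C.probOne τ ≤ 1 / 3) :=
  NoiseThresholdUpperBoundsNarrow.1 h k ε₁ εk hk hε₁ hεk

/-- … and where it stops: at depth `T` the noise-exempt idle wire still separates the two basis
inputs with the full bounded-error gap, for EVERY `T` (so no `T₁` as in `no_gap` exists once
`ε₁ = 0` is admitted). [cite: KempeEtAl2010, §1 (Significance of results)] -/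
theorem NoiseThresholdUpperBoundsNarrow.gap_without_wire_noise (T : ℕ) :
    (kruwIdleCircuit T).RatesAtLeast 0 1 ∧
      2 / 3 ≤ (kruwIdleCircuit T).probOne (qubitBasisDensity true) ∧
        (kruwIdleCircuit T).probOne (qubitBasisDensity false) ≤ 1 / 3 := by
  refine ⟨kruwIdleCircuit_ratesAtLeast T 1, ?_, ?_⟩ <;> norm_num [probOne_kruwIdleCircuit]


end Literature.Barriers.QuantumAdvantage

end
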